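import Mathlib
import Literature.Probability.LatticeModels.SCTWardIdentity
import Literature.Analysis.Distribution.FieldIntegrationByParts
import HarnessLib

/-!
# Stub C2 `stub_pointwise_of_ward` for crux `MoebiusLimitExists` (stmt-CriticalPhenomena-1344), line `Sketch` v13
(lead prover-line-stmt-CriticalPhenomena-1344-c18-0; THEOREM-ONLY, `--supports stmt-CriticalPhenomena-1344`)

Weak `K_b` Ward identity for all tests compactly supported in an open set where the level is real-analytic ⇒ the pointwise
special-conformal identity there (integration by parts, then the fundamental lemma of the calculus of variations + continuity).

Write `K(x) = (K_b(xᵢ))ᵢ`, `K_b(y) = ‖y‖² b − 2⟪b,y⟫ y` (`Literature.Probability.LatticeModels.sctField`), and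
`σ_b(x) = Σᵢ ⟪b, xᵢ⟫`. For a smooth `φ` compactly supported in `U` the vector field `Y = (φ F) • K` is `C¹` with compact
support, so `∫ div Y = 0` (`Literature.Analysis.Distribution.integral_fieldDiv_eq_zero`); expanding,
`div Y = F (Dφ·K) + φ (DF·K) + φ F div K` with `div K = Σᵢ div K_b(xᵢ) = −6 σ_b` (`trace_fderiv_sctField`, `d = 3`).
Subtracting this from the weak identity `∫ F [(2Δ−6) σ_b φ + Dφ·K] = 0` leaves `∫ φ · E = 0` for the defect
`E = 2Δ σ_b F − DF·K`, which is continuous on `U`; the fundamental lemma of the calculus of variations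
(`IsOpen.ae_eq_zero_of_integral_contDiff_smul_eq_zero`) and continuity (`Measure.eqOn_open_of_ae_eq`) give `E = 0` on `U`.
-/

noncomputable section

open Set Function MeasureTheory Filter Topology
open scoped RealInnerProductSpace
open Literature.Probability.LatticeModels
open Literature.Analysis.Distribution (fieldDiv fieldDiv_smul_apply fieldDiv_eq_sum_coord
  integral_fieldDiv_eq_zero)

namespace Summit.CriticalPhenomena.Ising3DConformalLimit.MoebiusLimitExistsSketchV13

variable {n : ℕ}

/-- The configuration field `x ↦ (K_b(xᵢ))ᵢ` is differentiable, with the block-diagonal derivative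
`v ↦ (DK_b(xᵢ) vᵢ)ᵢ`. [folklore] -/
theorem pointwiseOfWard_hasFDerivAt_cfgField (b : EuclideanSpace ℝ (Fin 3))
    (x : Fin n → EuclideanSpace ℝ (Fin 3)) :
    HasFDerivAt (fun (y : Fin n → EuclideanSpace ℝ (Fin 3)) (i : Fin n) => sctField b (y i))
      (ContinuousLinearMap.pi fun i =>
        (sctFieldDeriv b (x i)).comp (ContinuousLinearMap.proj (R := ℝ) i)) x :=
  hasFDerivAt_pi.2 fun i => by
    have h := (hasFDerivAt_sctField b (x i)).comp x (hasFDerivAt_apply (𝕜 := ℝ) i x)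
    exact h

/-- `K_b` is smooth (a polynomial vector field). [folklore] -/
theorem pointwiseOfWard_contDiff_sctField (b : EuclideanSpace ℝ (Fin 3)) {m : WithTop ℕ∞} :
    ContDiff ℝ m (sctField (d := 3) b) := by
  have h : sctField (d := 3) b = fun x => ‖x‖ ^ 2 • b - (2 * ⟪b, x⟫) • x := rfl
  rw [h]
  exact ((contDiff_norm_sq ℝ).smul contDiff_const).sub
    ((contDiff_const.mul (contDiff_const.inner ℝ contDiff_id)).smul contDiff_id)

/-- The configuration field `x ↦ (K_b(xᵢ))ᵢ` is smooth. [folklore] -/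
theorem pointwiseOfWard_contDiff_cfgField (b : EuclideanSpace ℝ (Fin 3)) {m : WithTop ℕ∞} :
    ContDiff ℝ m (fun (y : Fin n → EuclideanSpace ℝ (Fin 3)) (i : Fin n) => sctField b (y i)) :=
  contDiff_pi.2 fun i =>
    (pointwiseOfWard_contDiff_sctField b).comp (contDiff_apply ℝ (EuclideanSpace ℝ (Fin 3)) i)

/-- `div K_b = -6 ⟪b, ·⟫` on `ℝ³`, written in the standard basis. [folklore] -/
theorem pointwiseOfWard_sum_coord_sctFieldDeriv (b y : EuclideanSpace ℝ (Fin 3)) :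
    ∑ μ, (EuclideanSpace.basisFun (Fin 3) ℝ).toBasis.coord μ
        (sctFieldDeriv b y ((EuclideanSpace.basisFun (Fin 3) ℝ).toBasis μ)) = -6 * ⟪b, y⟫ := by
  have h := fieldDiv_eq_sum_coord (EuclideanSpace.basisFun (Fin 3) ℝ).toBasis (sctField b) y
  have ht := trace_fderiv_sctField b y
  rw [fieldDiv, (hasFDerivAt_sctField b y).fderiv] at h
  rw [(hasFDerivAt_sctField b y).fderiv] at ht
  rw [← h, ht]
  push_cast
  ring

/-- **The divergence of the configuration field**: `div (K_b(xᵢ))ᵢ = Σᵢ div K_b(xᵢ) = -6 Σᵢ ⟪b, xᵢ⟫`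
(`d = 3`). [folklore] -/
theorem pointwiseOfWard_fieldDiv_cfgField (b : EuclideanSpace ℝ (Fin 3))
    (x : Fin n → EuclideanSpace ℝ (Fin 3)) :
    fieldDiv (fun (y : Fin n → EuclideanSpace ℝ (Fin 3)) (i : Fin n) => sctField b (y i)) x =
      -6 * ∑ i, ⟪b, x i⟫ := by
  set B : Module.Basis (Fin 3) ℝ (EuclideanSpace ℝ (Fin 3)) :=
    (EuclideanSpace.basisFun (Fin 3) ℝ).toBasis with hB
  rw [fieldDiv_eq_sum_coord (Pi.basis fun _ : Fin n => B),
    (pointwiseOfWard_hasFDerivAt_cfgField b x).fderiv, Fintype.sum_sigma, Finset.mul_sum]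
  refine Finset.sum_congr rfl fun i _ => ?_
  rw [← pointwiseOfWard_sum_coord_sctFieldDeriv b (x i)]
  refine Finset.sum_congr rfl fun μ _ => ?_
  simp only [Module.Basis.coord_apply, Pi.basis_repr, Pi.basis_apply, ContinuousLinearMap.pi_apply,
    ContinuousLinearMap.comp_apply, ContinuousLinearMap.proj_apply,
    Pi.single_eq_same, hB]

/-- A function `g` continuous on an open set `V`, multiplied by a continuous `ψ` vanishing off a compact
subset `K ⊆ V`, gives a continuous, compactly supported — hence integrable — product. [folklore] -/
theorem pointwiseOfWard_integrable_mul {g ψ : (Fin n → EuclideanSpace ℝ (Fin 3)) → ℝ}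
    {V K : Set (Fin n → EuclideanSpace ℝ (Fin 3))} (hV : IsOpen V) (hg : ContinuousOn g V)
    (hψ : Continuous ψ) (hK : IsCompact K) (hKV : K ⊆ V) (hψK : ∀ x, x ∉ K → ψ x = 0) :
    Integrable (fun x => g x * ψ x) := by
  have hc : Continuous fun x => g x * ψ x := by
    refine continuous_iff_continuousAt.2 fun x => ?_
    by_cases hx : x ∈ V
    · exact ((hg x hx).continuousAt (hV.mem_nhds hx)).mul hψ.continuousAt
    · have hxK : x ∉ K := fun h => hx (hKV h)
      have hev : (fun y => g y * ψ y) =ᶠ[𝓝 x] fun _ => 0 := by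
        filter_upwards [hK.isClosed.isOpen_compl.mem_nhds hxK] with y hy
        rw [hψK y hy, mul_zero]
      exact continuousAt_const.congr hev.symm
  have hsupp : support (fun x => g x * ψ x) ⊆ K := fun y hy =>
    by_contra fun h => hy (by simp [hψK y h])
  exact hc.integrable_of_hasCompactSupport
    (hK.of_isClosed_subset (isClosed_tsupport _) (closure_minimal hsupp hK.isClosed))

/-- **Integration by parts against the configuration field.** For `F` real-analytic on an open `U` and a
smooth `φ` compactly supported in `U`:
`∫ [F (Dφ·K) + φ (DF·K) − 6 σ_b φ F] = ∫ div((φF) K) = 0`. [folklore] -/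
theorem pointwiseOfWard_integral_fieldDiv {F φ : (Fin n → EuclideanSpace ℝ (Fin 3)) → ℝ}
    {U : Set (Fin n → EuclideanSpace ℝ (Fin 3))} (b : EuclideanSpace ℝ (Fin 3)) (hF : AnalyticOnNhd ℝ F U)
    (hφ : ContDiff ℝ ((⊤ : ℕ∞) : WithTop ℕ∞) φ) (hφU : tsupport φ ⊆ U) (hφc : HasCompactSupport φ) :
    ∫ x, (F x * fderiv ℝ φ x (fun i => sctField b (x i)) +
        φ x * fderiv ℝ F x (fun i => sctField b (x i)) - 6 * (∑ i, ⟪b, x i⟫) * (φ x * F x)) = 0 := by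
  set K : (Fin n → EuclideanSpace ℝ (Fin 3)) → (Fin n → EuclideanSpace ℝ (Fin 3)) :=
    fun y i => sctField b (y i) with hK
  have hφ1 : ContDiff ℝ 1 φ := hφ.of_le (by exact_mod_cast le_top)
  -- `φ F` is `C¹`: near points of `U` by analyticity, elsewhere it vanishes identically
  have hφF : ContDiff ℝ 1 fun y => φ y * F y := by
    refine contDiff_iff_contDiffAt.2 fun x => ?_
    by_cases hx : x ∈ U
    · exact hφ1.contDiffAt.mul (hF x hx).contDiffAt
    · have hx' : x ∉ tsupport φ := fun h => hx (hφU h)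
      have h0 : (fun y => φ y * F y) =ᶠ[𝓝 x] fun _ => 0 := by
        filter_upwards [(isClosed_tsupport φ).isOpen_compl.mem_nhds hx'] with y hy
        rw [image_eq_zero_of_notMem_tsupport hy, zero_mul]
      exact contDiffAt_const.congr_of_eventuallyEq h0
  have hKd : ContDiff ℝ 1 K := pointwiseOfWard_contDiff_cfgField b
  set Y : (Fin n → EuclideanSpace ℝ (Fin 3)) → (Fin n → EuclideanSpace ℝ (Fin 3)) :=
    fun y => (φ y * F y) • K y with hY
  have hYd : ContDiff ℝ 1 Y := hφF.smul hKd
  have hYc : HasCompactSupport Y := (hφc.mul_right (f' := F)).smul_right (f' := K)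
  have hdiv : ∀ x, fieldDiv Y x = F x * fderiv ℝ φ x (K x) + φ x * fderiv ℝ F x (K x) -
      6 * (∑ i, ⟪b, x i⟫) * (φ x * F x) := by
    intro x
    rw [hY, fieldDiv_smul_apply ((hφF.differentiable one_ne_zero) x)
      ((hKd.differentiable one_ne_zero) x), pointwiseOfWard_fieldDiv_cfgField]
    by_cases hx : x ∈ U
    · rw [fderiv_fun_mul ((hφ1.differentiable one_ne_zero) x) (hF x hx).differentiableAt]
      simp only [add_apply, smul_apply, smul_eq_mul]
      ring
    · have hx' : x ∉ tsupport φ := fun h => hx (hφU h)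
      have hx'' : x ∉ tsupport fun y => φ y * F y := fun h => hx' (tsupport_mul_subset_left h)
      rw [fderiv_of_notMem_tsupport ℝ hx'', fderiv_of_notMem_tsupport ℝ hx',
        image_eq_zero_of_notMem_tsupport hx']
      simp
  have h0 := integral_fieldDiv_eq_zero (μ := volume) hYd hYc
  simp only [hdiv] at h0
  exact h0

/-- **Stub C2 — `stub_pointwise_of_ward`** (registered signature). [cite: FrancescoMathieuSenechal1997, §4.3.1 (4.51)–(4.54)] -/
theorem stub_pointwise_of_ward : ∀ (n : ℕ) (F : (Fin n → EuclideanSpace ℝ (Fin 3)) → ℝ) (Δ : ℝ)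
    (b : EuclideanSpace ℝ (Fin 3)) (U : Set (Fin n → EuclideanSpace ℝ (Fin 3))), IsOpen U → AnalyticOnNhd ℝ F U →
    (∀ (φ : (Fin n → EuclideanSpace ℝ (Fin 3)) → ℝ),
      ContDiff ℝ ((⊤ : ℕ∞) : WithTop ℕ∞) φ → HasCompactSupport φ → tsupport φ ⊆ U →
      ∫ x, F x * ((2 * Δ - 6) * (∑ i, inner ℝ b (x i)) * φ x +
        fderiv ℝ φ x (fun i => ‖x i‖ ^ 2 • b - (2 * inner ℝ b (x i)) • x i)) = 0) →
    ∀ x ∈ U, fderiv ℝ F x (fun i => ‖x i‖ ^ 2 • b - (2 * inner ℝ b (x i)) • x i) =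
      2 * Δ * (∑ i, inner ℝ b (x i)) * F x := by
  intro n F Δ b U hU hF hW x hx
  have hKdef : ∀ y : Fin n → EuclideanSpace ℝ (Fin 3),
      (fun i => ‖y i‖ ^ 2 • b - (2 * inner ℝ b (y i)) • y i) = fun i => sctField b (y i) :=
    fun y => rfl
  simp only [hKdef] at hW ⊢
  have hKc : Continuous fun (y : Fin n → EuclideanSpace ℝ (Fin 3)) (i : Fin n) => sctField b (y i) :=
    (pointwiseOfWard_contDiff_cfgField (m := 1) b).continuous
  -- the defect and its continuity on `U`
  set E : (Fin n → EuclideanSpace ℝ (Fin 3)) → ℝ := fun y =>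
    2 * Δ * (∑ i, ⟪b, y i⟫) * F y - fderiv ℝ F y (fun i => sctField b (y i)) with hE
  have hσ : Continuous fun y : Fin n → EuclideanSpace ℝ (Fin 3) => 2 * Δ * ∑ i, ⟪b, y i⟫ := by
    fun_prop
  have hEc : ContinuousOn E U :=
    (hσ.continuousOn.mul hF.continuousOn).sub (hF.fderiv.continuousOn.clm_apply hKc.continuousOn)
  -- `∫ φ E = 0` for every smooth `φ` compactly supported in `U`
  have hint : ∀ φ : (Fin n → EuclideanSpace ℝ (Fin 3)) → ℝ, ContDiff ℝ ((⊤ : ℕ∞) : WithTop ℕ∞) φ →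
      HasCompactSupport φ → tsupport φ ⊆ U → ∫ y, φ y • E y = 0 := by
    intro φ hφ hφc hφU
    have hφ0 : Continuous φ := hφ.continuous
    have hD0 : Continuous (fderiv ℝ φ) := hφ.continuous_fderiv (by simp)
    -- integrability of the Ward integrand and of `φ E`
    have hIW : Integrable fun y : Fin n → EuclideanSpace ℝ (Fin 3) =>
        F y * ((2 * Δ - 6) * (∑ i, ⟪b, y i⟫) * φ y + fderiv ℝ φ y (fun i => sctField b (y i))) := by
      refine pointwiseOfWard_integrable_mul hU hF.continuousOn ?_ hφc hφU fun y hy => ?_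
      · exact (by fun_prop : Continuous fun y : Fin n → EuclideanSpace ℝ (Fin 3) =>
            (2 * Δ - 6) * (∑ i, ⟪b, y i⟫) * φ y).add (hD0.clm_apply hKc)
      · simp [image_eq_zero_of_notMem_tsupport hy, fderiv_of_notMem_tsupport ℝ hy]
    have hIE : Integrable fun y : Fin n → EuclideanSpace ℝ (Fin 3) => E y * φ y :=
      pointwiseOfWard_integrable_mul hU hEc hφ0 hφc hφU fun y hy =>
        image_eq_zero_of_notMem_tsupport hy
    have hparts := pointwiseOfWard_integral_fieldDiv b hF hφ hφU hφc
    have hsplit : (fun y : Fin n → EuclideanSpace ℝ (Fin 3) =>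
        F y * fderiv ℝ φ y (fun i => sctField b (y i)) +
          φ y * fderiv ℝ F y (fun i => sctField b (y i)) - 6 * (∑ i, ⟪b, y i⟫) * (φ y * F y)) =
        fun y => F y * ((2 * Δ - 6) * (∑ i, ⟪b, y i⟫) * φ y +
          fderiv ℝ φ y (fun i => sctField b (y i))) - E y * φ y := by
      funext y
      simp only [hE]
      ring
    rw [hsplit, integral_sub hIW hIE, hW φ hφ hφc hφU, zero_sub, neg_eq_zero] at hparts
    rw [← hparts]
    exact integral_congr_ae (Eventually.of_forall fun y => by simp [smul_eq_mul, mul_comm])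
  -- fundamental lemma of the calculus of variations, then continuity on the open set `U`
  have hae : ∀ᵐ y ∂(volume : Measure (Fin n → EuclideanSpace ℝ (Fin 3))), y ∈ U → E y = 0 :=
    hU.ae_eq_zero_of_integral_contDiff_smul_eq_zero (hEc.locallyIntegrableOn hU.measurableSet) hint
  have hae' : E =ᵐ[(volume : Measure (Fin n → EuclideanSpace ℝ (Fin 3))).restrict U]
      fun _ => (0 : ℝ) := by
    rw [EventuallyEq, ae_restrict_iff' hU.measurableSet]
    filter_upwards [hae] with y hy hyU
    exact hy hyU
  have hzero : EqOn E (fun _ => (0 : ℝ)) U :=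
    Measure.eqOn_open_of_ae_eq hae' hU hEc continuousOn_const
  have hx0 := hzero hx
  simp only [hE] at hx0
  linarith

end Summit.CriticalPhenomena.Ising3DConformalLimit.MoebiusLimitExistsSketchV13

end
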